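import Summits.BirchSwinnertonDyer.Rank1Residual.O6.X3KatoMemberBound
import Literature.NumberTheory.EllipticCurves.Kato2004.MemberHullInputs
import Literature.NumberTheory.EllipticCurves.Kato2004.HullDescentMultiplierProofs
import Literature.NumberTheory.EllipticCurves.KatoRankBoundProofs
import Literature.NumberTheory.EllipticCurves.ShaIsogenyProofs
import Literature.NumberTheory.EllipticCurves.IwasawaAlgebraProofs
import HarnessLib

/-!
# Cell `bsd-potss`, routes `KatoDescentPotSupersingular` (K9) / `KatoDescentTamePotSupersingular` (K8-t′):
# the node `O6.KatoMemberShaBoundOfReducible` (= the SHARED crux M `ReducibleKatoMember`, item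
# stmt-BirchSwinnertonDyer-19196) FROM KATO'S PUBLISHED INPUTS AT HIS MEMBER — ROUTE-FREE module
# (imports NO `Theses.*` file, so a route file / `closes` may import it):
# `nonempty_iwasawaH1Data → exists_isNewformOf → exists_memberHullInputs → O6.KatoMemberShaBoundOfReducible`

PROVENANCE: the theorem and its proof are seat `bsd-potss-rkm` generation 3's STAGED part P3
(HOME/rkm/KatoDescentPotSupersingularReducibleKatoMemberOfInputs.lean, rc 0, "filed the moment p439134 is
accepted" — HANDOFF rkm g3 10:53Z; p439134 `Kato2004/MemberHullInputs.lean` ACCEPTED 11:22Z after that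
seat closed), re-homed UNCHANGED into a route-free module by seat `bsd-potss-kmc` generation 9 (the
planner's option (b) of INBOX 11:12:55Z needs a module importable from the route files); the route-typed
restatements are the sibling files `KatoDescent{,Tame}PotSupersingularReducibleKatoMemberOfInputs.lean`.

The node (T-X3K): at an odd additive potentially good prime `p` with `E[p]` reducible, `L(E,1) ≠ 0`,
`Ш(E)` finite, SOME `ℚ`-isogenous globally minimal `W'` satisfies `ord_p #Ш(W')[p^∞] + ord_p Tam(W') ≤
ord_p (L(W',1)/Ω(W')) + 3·ord_p #W'(ℚ)_tors`.  It is derived from THREE NAMED LITERATURE FACTS and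
nothing else:
* `Kato2004.nonempty_iwasawaH1Data` (Kato §12.2 (12.2.1) / §13.8: the pinned `𝐇¹_Γ(T_pW)` exists —
  construction fact of `Kato2004/IwasawaCohomology.lean`, already used by K6);
* `ModularForms.exists_isNewformOf` (modularity: a newform of `W` exists; Diamond–Shurman 8.8.3 /
  BCDT — the tree's root modularity fact);
* `Kato2004.exists_memberHullInputs` (Kato Thm. 12.4, 12.5 (1)–(3), 12.6 + Lemma 13.10 (1) + 13.14,
  §14.14, Thm. 14.5 (1)(2), Prop. 14.16 (2) + §14.8 / Greenberg 4.13 / Kim §3.2.3, Wuthrich 2014 L.14,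
  AT KATO'S LATTICE `T = V_{ℤ_p}(f)(1)`: the rank-`0` descent inputs exist on the pinned triple
  `(𝐇¹_Γ(T_pW_K), 𝐲, H¹(ℤ[1/p],T_pW_K))` — file `Kato2004/MemberHullInputs.lean`, seat rkm P2, p439134),
through the tree's PROVED module theory `Kato2004.valuation_add_padicValNat_coinvariants_le_of_hull_smul`
(`Kato2004/HullDescentMultiplierProofs.lean`, p437777: Kato §14.14–14.15 through the reflexive hull with the
`(c,d,a(A))`-multiplier, `v_p(λ(0)) + ord_p #(𝐇²/X𝐇²) ≤ ord_p [A : Λ·ι(𝐲̄)]`) and the kernel plumbing: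
Kato's Euler system at the member (`ZetaBody`, inside the fact) ⟶ the pinned class `𝐲`
(`IwasawaH1Data.existsUnique_lift_of_zetaBody`, p431097) ⟶ the package ⟶ hull descent + count ⟶ T-X3K.
The proof: take the member `W'`, a newform `f`, any embeddings `ι`, the fact's `ZetaBody` datum, a
cyclotomic `κ` with topological generator `γ` (`exists_isCyclotomic_isTopGenerator_isCyclotomicVariable_holds`,
PROVED), `I` from `nonempty_iwasawaH1Data`, the lift `𝐲`, the package `K`; assemble the divisibility for the
hull at every height-one prime from `K.divisibility_offP` (Thm. 12.5 (3)) and `K.mu_H2` (Wuthrich L.14);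
run the hull descent; add the count; the multiplier term `v_p(λ(0))` and the `𝐇²` term cancel:
`ord_p #Ш(W') + v_p Tam(W') ≤ ord_p q + 3t`.  CONDITIONAL (audit `proof.conditional`) on exactly the
three named facts; no item is closed by this file (the planner may restate 19196 as
«(nonempty_iwasawaH1Data ∧ exists_isNewformOf ∧ exists_memberHullInputs) → ReducibleKatoMember», cf.
the K8 precedent 19301 `PublishedInputKO13`, or add the conjunction as a cite-only input and derive `h₃`
inside `closes` by `ReducibleKatoMemberOfInputs.katoMemberShaBoundOfReducible_of_inputs_and`).
HONEST FRAMING: BSD is not advanced; M's non-CM rows are still "Kato's Euler-system bound at an additive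
prime with `E[p]` reducible", now resting on ONE named transcription of Kato's statements at his member
instead of on three free hypothesis schemata (cf. the tightness theorem
`O6.KatoMemberShaBoundOfReducible.iff_exists_hullReadings`, p427116).

References: [Kato2004Asterisque] Thm. 12.4–12.6 (pp. 221–222), Lemma 13.10 (1) (p. 230), 13.14 (p. 234),
Thm. 14.5 (p. 236), §14.8 (p. 238), §14.14–Lemma 14.15 (pp. 243–244), Prop. 14.16 (2) (p. 244);
[Wuthrich2014] Lemma 12, Lemma 14; [GreenbergLNM1716] Prop. 4.13, §3; [Kim2022StructureSelmer] §3.2.3;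
[DiamondShurman2005] Thm. 8.8.3.
-/

set_option autoImplicit false
-- sibling precedent (`KatoDescentPotSupersingularAssembly.lean`): the directory name repeats the summit name
set_option linter.dupNamespace false

noncomputable section

open scoped Classical

namespace Summit.BirchSwinnertonDyer.BirchSwinnertonDyer.Theorems.ReducibleKatoMemberOfInputs

open WeierstrassCurve Literature.NumberTheory.EllipticCurves
  Literature.NumberTheory.EllipticCurves.ModularForms
  Literature.NumberTheory.EllipticCurves.Kato2004
  Literature.NumberTheory.EllipticCurves.IwasawaAlgebra

/-- **The node T-X3K (`O6.KatoMemberShaBoundOfReducible`) from Kato's published inputs at his member.**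
Granted the named facts `nonempty_iwasawaH1Data` (Kato §12.2: the pinned `𝐇¹_Γ(T_pW)` exists),
`exists_isNewformOf` (modularity) and `exists_memberHullInputs` (Kato Thm. 12.4, 12.5 (1)–(3), 12.6 +
13.10 (1) + 13.14, §14.14, 14.5 (1)(2), 14.16 (2) + §14.8, Wuthrich L.14 at `T = V_{ℤ_p}(f)(1)`): for
`W/ℚ` globally minimal, `p ≠ 2` additive potentially good, `W[p]` reducible, `L(W,1) ≠ 0`, `Ш(W)`
finite, Kato's member `W' ∼ W` satisfies `ord_p #Ш(W')[p^∞] + v_p Tam(W') ≤ ord_p(L(W',1)/Ω(W')) +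
3·ord_p #W'(ℚ)_tors`.  Proof = module docstring: `ZetaBody` datum ⟶ pinned `𝐲` ⟶ package `K` ⟶
`Kato2004.valuation_add_padicValNat_coinvariants_le_of_hull_smul` (`v_p(λ(0)) + ord #(𝐇²/X𝐇²) ≤
ord [A : ι𝐲̄]`) + `K.count` ⟶ cancel.  Conditional on the three named facts; nothing else assumed.
[cite: Kato2004Asterisque, Thm. 12.6 (p. 222), Lemma 13.10 (1) (p. 230), 13.14 (p. 234), §14.14 and Lemma 14.15 (pp. 243–244), Prop. 14.16 (2) (p. 244), §14.8 (p. 238)]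
[cite: Wuthrich2014, Lemma 12 (p. 395), Lemma 14 (p. 396)] -/
theorem katoMemberShaBoundOfReducible_of_memberHullInputs (hne : Kato2004.nonempty_iwasawaH1Data)
    (hmod : exists_isNewformOf) (hin : Kato2004.exists_memberHullInputs) :
    Summit.BirchSwinnertonDyer.Rank1Residual.O6.KatoMemberShaBoundOfReducible := by
  intro W _ _ p _ hp hng hnm hj hred hL hfin
  -- Kato's member `W'` and the fact's data at it
  obtain ⟨W', hE', hM', hiso, hrest⟩ := hin W p hp hng hnm hj hred hL hfin
  haveI := hE'
  haveI := hM'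
  haveI : ContinuousSMul ℤ_[p] (W'.tateModule p) := TateModule.continuousSMul_padicInt
  haveI : Module.Free ℤ_[p] (W'.tateModule p) := W'.module_free_tateModule_holds p
  haveI : Module.Finite ℤ_[p] (W'.tateModule p) := W'.module_finite_tateModule_holds p
  -- a newform of `W` (modularity) and a family of complex embeddings of the cyclotomic fields
  haveI : NeZero (W.conductorNorm ℤ) := ⟨(W.conductorNorm_pos_holds).ne'⟩
  obtain ⟨f, hf⟩ := hmod W
  obtain ⟨κ', Λ', c, d, a, A, z, x, -, -, -, -, hbody, hpack⟩ :=
    hrest f hf (fun m => Classical.arbitrary _)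
  -- the cyclotomic `ℤ_p`-tower with a topological generator (PROVED), the pinned `𝐇¹_Γ(T_pW')`, the lift `𝐲`
  obtain ⟨κ, hκ, γ, hγ, -⟩ := exists_isCyclotomic_isTopGenerator_isCyclotomicVariable_holds p
  obtain ⟨I⟩ := hne W' p κ γ hκ hγ
  obtain ⟨y, hy⟩ :=
    (IwasawaH1Data.existsUnique_lift_of_zetaBody p W' hκ hp I f _ κ' Λ' c d a A z x hbody).exists
  -- the package at `(I, 𝐲)`
  obtain ⟨K⟩ := hpack κ γ hκ hγ I y hy
  have hfin' : Finite W'.sha := (IsIsogenous.shaFinite_iff_shaFinite hiso).mp hfin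
  haveI := K.finite_H
  haveI := K.torsionFree_H
  haveI := K.finite_F
  haveI := K.torsionFree_F
  haveI := K.finite_H2
  -- the divisibility for the hull at EVERY height-one prime: off `(p)` Thm. 12.5 (3), at `(p)` `μ = 0`
  have hdiv : ∀ 𝔮 : PrimeSpectrum (IwasawaAlgebra p), 𝔮.asIdeal.height = 1 →
      Module.lengthAt (IwasawaAlgebra p) K.H2 𝔮 ≤
        Module.lengthAt (IwasawaAlgebra p) (K.F ⧸ (IwasawaAlgebra p) ∙ K.z) 𝔮 := by
    intro 𝔮 h𝔮
    by_cases hq : 𝔮.asIdeal = augIdealP p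
    · have hμ : (Module.lengthAt (IwasawaAlgebra p) K.H2 𝔮).toNat = 0 := by
        rw [← muInvariant_eq_toNat_lengthAt p K.H2 𝔮 hq]; exact K.mu_H2
      have hfinl : Module.lengthAt (IwasawaAlgebra p) K.H2 𝔮 ≠ ⊤ :=
        IwasawaAlgebra.lengthAt_ne_top_of_isTorsion K.H2 K.isTorsion_H2 𝔮 (le_of_eq h𝔮)
      have h0' : Module.lengthAt (IwasawaAlgebra p) K.H2 𝔮 = 0 := by
        rw [← ENat.coe_toNat hfinl, hμ]; rfl
      rw [h0']
      exact bot_le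
    · exact K.divisibility_offP 𝔮 h𝔮 hq
  -- the hull descent with the multiplier (PROVED module theory over `ℤ_p⟦X⟧`)
  have hhull := valuation_add_padicValNat_coinvariants_le_of_hull_smul K.j K.j_injective
    K.finite_coker K.z K.z_ne_zero K.isTorsion_quotient K.isTorsion_H2 hdiv y K.lam
    K.lam_constantCoeff_ne_zero K.j_y K.ι K.π K.ι_injective K.π_surjective K.exact_ι_π
    K.finite_coinvariants_H2 K.index_ne_zero
  -- the count; the multiplier and the `𝐇²` terms cancel
  obtain ⟨q, hq, hcount⟩ := K.count
  refine ⟨W', hE', hM', hiso, hfin', q, hq, ?_⟩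
  have hhull' : ((PowerSeries.constantCoeff K.lam).valuation : ℤ) +
      (padicValNat p (Nat.card (coinvariants p K.H2)) : ℤ) ≤
      (padicValNat p (Nat.card (K.A ⧸ (IwasawaAlgebra p) ∙ K.ι (Submodule.Quotient.mk y))) : ℤ) := by
    exact_mod_cast hhull
  linarith

/-- **Conjunction form** (the shape a cite-only input item «published inputs for M» would have, K8
precedent `PublishedInputKO13`): `(nonempty_iwasawaH1Data ∧ exists_isNewformOf ∧ exists_memberHullInputs)
→ O6.KatoMemberShaBoundOfReducible`.  Conditional; nothing else assumed.
[cite: Kato2004Asterisque, Thm. 12.6 (p. 222), §14.14 and Lemma 14.15 (pp. 243–244), Prop. 14.16 (2) (p. 244)]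
[cite: Wuthrich2014, Lemma 14 (p. 396)] -/
theorem katoMemberShaBoundOfReducible_of_inputs_and
    (h : Kato2004.nonempty_iwasawaH1Data ∧ exists_isNewformOf ∧ Kato2004.exists_memberHullInputs) :
    Summit.BirchSwinnertonDyer.Rank1Residual.O6.KatoMemberShaBoundOfReducible :=
  katoMemberShaBoundOfReducible_of_memberHullInputs h.1 h.2.1 h.2.2

end Summit.BirchSwinnertonDyer.BirchSwinnertonDyer.Theorems.ReducibleKatoMemberOfInputs

end
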